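import Mathlib
import HarnessLib
import HarnessLib.Audit
import Summits.Parity.Statement
import Literature.NumberTheory.Sieve.CubicMinorantDefs
import Literature.NumberTheory.Sieve.HeathBrownCubicPrimesHolds
import Literature.NumberTheory.Waring.HuaLemmaCubes
import HarnessLib.Audit.Status.Attr

/-!
Route: HeathBrownPrimeAP3

CLOSED (proved) 2026-08-26T18:18:41Z by planner-parity-ideate-p2-g5-0 — reason: proved:Summit.Parity.GeneralizedHardyLittlewood.Theses.HeathBrownPrimeAP3.heathBrownPrimeAP3_holds — note: PROVED close (route pen p2, per TURNKEY §after; ref g23 verdicts 17:18/17:21Z): target stmt-Parity-19662 = the D-0061 rung leaf F-P1 (operator-registered), proved by heathBrownPrimeAP3_holds (p457736, commit 6d99ae611af7, axioms std) := closes mainTermLowerAP_holds errorTermBoundAP_holds readoutAP_h. The file is kept as the record of this route; refuted decls are indexed as negative knowledge (`ledger negatives`).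

# Route HeathBrownPrimeAP3 — infinitely many prime 3-APs p < π < r whose middle term is a
Heath-Brown prime x³+2y³

X = the five analytic blocks of a weighted binary circle method at scale M = 2N with the middle
variable running over
Heath-Brown primes π = x³+2y³ ∈ (N/2, N] (weight `CubicMinorant.apWeight c N`, supported on k = 2N −
2π): X = MainTermLowerAP ∧
ErrorTermBoundAP ∧ ReadoutAP ∧ RoughModelFourierApprox ∧ HBFourierFourthMoment. It suffices to show
X: with A = 8c + C₄⁺ + 8
the main term c_M (log 2N)^(−2c) (2N)² beats the error C'(2N)²(log 2N)^(−2c−1/4) plus the no-AP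
read-out C''(2N)^(3/2)(log 2N)⁴,
so for every large N some Heath-Brown prime π ∈ (N/2, N] is the middle term of a non-trivial prime
3-AP p + r = 2π — the rung
target item `HeathBrownPrimeAP3` = the rung leaf (D-0061 rung F-P1 of Parity, cell parity-ideate
seat p2, Line F; filed as this route's own `target` item, option (i), and to be registered as
ALT-CLOSER). All five blocks and the deciding
theorem are KERNEL-PROVED in cell evidence
`pub/parity-ideate/parity-ideate-p2/evidence/HeathBrownPrimeAP3.lean` (6052 lines,
farm rc 0, 0 sorries, axioms propext/Classical.choice/Quot.sound); this route is the PORT of that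
theorem into the tree.
Lean: `Summit.Parity.GeneralizedHardyLittlewood.Theses.HeathBrownPrimeAP3.MainTermLowerAP ∧
Summit.Parity.GeneralizedHardyLittlewood.Theses.HeathBrownPrimeAP3.ErrorTermBoundAP ∧
Summit.Parity.GeneralizedHardyLittlewood.Theses.HeathBrownPrimeAP3.ReadoutAP ∧
Summit.Parity.GeneralizedHardyLittlewood.Theses.HeathBrownPrimeAP3.RoughModelFourierApprox ∧
Summit.Parity.GeneralizedHardyLittlewood.Theses.HeathBrownPrimeAP3.HBFourierFourthMoment`

## Assembly
Pure bookkeeping (KERNEL-PROVED as `heathBrownPrimeAP3_of_parts` in the evidence and re-certified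
here as `closes`): fix c, κ from
Heath-Brown's asymptotic (tree theorem `CubicPrimes.HeathBrown2001_primePairCount_asymptotic_holds`
⇒ π(𝒜)(X, (log X)^(−c)) ≥ (σ₀/6)η²X²/log X
eventually), take C₄, c₁ from HBFourierFourthMoment, A = 8c + max C₄ 0 + 8 and B from
RoughModelFourierApprox, then MainTermLowerAP − ErrorTermBoundAP
contradicts ReadoutAP for N ≥ N₁+N₃+N₄+N₅ since (1−A)/4 + 3/2 + C₄⁺/4 = −2c − 1/4 and (2N)^(3/2)(log
2N)^(4+2c) = o((2N)²).

CLOSES_TARGET: closes rung F-P1 of Parity: Summit.Parity.GeneralizedHardyLittlewood.Theses.HeathBrownPrimeAP3.HeathBrownPrimeAP3 (D-0061; not the summit Statement) — the deciding theorem of this route concludes that registered leaf instead of the Statement decl `GeneralizedHardyLittlewood` (class rung: servable and labelled, never counted as concluding the summit Statement).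

Rationale: WHY THIS LINE. Mechanism: Green's transference principle run as an explicit weighted ternary count
T_M(Λ, Λ, w) = Σ_(n₁+n₂=k) Λ(n₁)Λ(n₂)w(k)
(HeathBrownActa2001 supplies ≫ η²X²/log X primes x³+2y³ with X³ ≍ N, a set of N^(2/3−o(1)) elements
— far too thin for
density or for the Montgomery–Vaughan exceptional-set pigeonhole, MontgomeryVaughan1975), with Λ
replaced by the W-rough model
g_B (RoughModelFourierApprox, from the tree's Siegel–Walfisz + Vaughan identity, Vaughan1997 ch. 3)
at a cost controlled by
Hölder (sup|Λ̂−ĝ|)^(1/2)·(∫|Λ̂−ĝ|²)^(1/4)·(∫|Λ̂|²)^(1/2)·(∫|ŵ|⁴)^(1/4), where the fourth moment of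
the Heath-Brown
exponential sum is bounded through the cubic Weyl sum by Hua's lemma with logarithmic loss (tree:
Literature.NumberTheory.Waring.HuaCubes.huaEighthMomentLog_holds,
Vaughan1986Cubes Thm 2). Imported areas: additive combinatorics (restriction/transference for
L⁴-controlled thin sets,
GreenTao2006Restriction, Green2005) and the classical circle method (Vinogradov1937, Nathanson1996
ch. 8); the reflection k = 2π
turns the 3-AP condition p + r = 2π into a binary Goldbach count for the even numbers 2π weighted by
the HB representation
number, which is exactly the ternary shape the Line E engine (sibling route VinogradovHeathBrown)
already proves. No prior
route of the sub touches polynomial prime values in additive patterns; the negatives index (4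
entries) is disjoint.

RANKED CRUXES. #0 HeathBrownPrimeAP3 (target) — the rung leaf itself, as this route's target item
(D-0061 option (i), precedent route-Parity-FordMaynardNoSieveConst0164): there is N₀ such that for
every N ≥ N₀ there are primes p, r and a prime x³+2y³ (x, y ≥ 1) with p < x³+2y³, p + r = 2(x³+2y³)
and N/2 < x³+2y³ ≤ N — byte-identical body to the refereed leaf text
`pub/parity-ideate/parity-ideate-p2/leaves/HeathBrownPrimeAP3Statement.lean` (= `rfl` to the
operator leaf `Summit.Parity.GeneralizedHardyLittlewood.HeathBrownPrimeAP3` if/when that is landed);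
to be registered as the rung's ALT-CLOSER, after which `route edit --closes-target` serves the
route. KERNEL-PROVED in cell evidence (`ParityIdeateP2.LineF.heathBrownPrimeAP3_holds`,
evidence/LineEFG_tree.lean, rc 0, axioms std). (why it might fail: it cannot mathematically
(kernel-proved in the cell evidence from the five blocks below); the port can only bounce on a
namespace/normalisation drift between the landed CubicMinorantDefs and the evidence.)
[HeathBrownActa2001, Green2005, Vaughan1997]
#2 ErrorTermBoundAP (crux) — for the AP weight at scale 2N, |T(Λ,Λ,w) − T(g_B,g_B,w)| ≤ C'(2N)²(log
2N)^((1−A)/4+3/2+C₄/4) given E2's sup bound with exponent A and the fourth-moment bound with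
exponent C₄ (block F2 of the evidence; E5 Hölder counting lemma at scale 2N). [difficulty: M] (why
it might fail: PROVED in cell evidence (errorTermBoundAP_holds); as a port it fails only if the
tree's Hua normalisation (cubicWeylSum over [1,P], log-power C) mismatches the evidence's E4b bridge
hbFourthMomentReduction — then ≈300 lines of re-bridging.) [Vaughan1997, GreenTao2006Restriction,
Vaughan1986Cubes]
#3 MainTermLowerAP (crux) — the rough-model main term: T(g_B, g_B, w) ≥ c_M (log 2N)^(−2c) (2N)² for
N ≥ N₀, from the rough-pair lower bound Σ_(n₁+n₂=2π) g g ≥ c₀·2π uniformly in even 2π ∈ (N, 2N] and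
Heath-Brown's count of π (block F1; needs HB's lower bound as the hypothesis displayed).
[difficulty: M] (why it might fail: PROVED in cell evidence (mainTermLowerAP_holds, c_M = c₀κ/32);
port risk only: the singular-series-free lower bound uses evenness of k = 2π and the primorial level
W = W(B,2N) of the defs leaf verbatim.) [HeathBrownActa2001, Nathanson1996]
#4 ReadoutAP (crux) — if no Heath-Brown prime π ∈ (N/2, N] is the middle of a non-trivial prime 3-AP
then T(Λ,Λ,w) ≤ C''(2N)^(3/2)(log 2N)⁴: only the diagonal n₁ = n₂ = π and prime-power terms survive
(block F3, C'' = 45, N₀ = 126). [difficulty: S] (why it might fail: PROVED in cell evidence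
(readoutAP_holds); port risk only: Chebyshev bounds for prime powers
(Mathlib.NumberTheory.Chebyshev) and the representation bound hbRep ≤ #pairs used verbatim.)
[HeathBrownActa2001, Nathanson1996]
#9 RoughModelFourierApprox (support) — E2 of Line E (shared with route VinogradovHeathBrown): for
every A > 0 there is B > 0 with sup_α |Λ̂_N(α) − ĝ_(B,N)(α)| ≤ C N (log N)^(−A), g the W-rough model
of level (log N)^B (Siegel–Walfisz on major arcs, Vaughan/Vinogradov on minor arcs; PROVED in
evidence, 1805-line block, lit port text port/LineERoughModel.lean). [difficulty: L] [Vaughan1997,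
IwaniecKowalski2004, Green2005]
#9 HBFourierFourthMoment (support) — E4 of Line E (shared): ∫₀¹ |Σ_π hbWeight(π) e(πα)|⁴ dα ≤ c₁ N³
(log N)^C — from Hua's eighth-moment lemma with logarithmic loss (tree theorem
huaEighthMomentLog_holds, p406333) via the PROVED reduction hbFourthMomentReduction (Cauchy–Schwarz
in y, sixteen-fold cubic equation count). [difficulty: M] [Vaughan1986Cubes, Vaughan1997,
HeathBrownActa2001]

TWO-LAYER PLAN. ErrorTermBoundAP ⇐ HolderCounting (E5 at scale 2N: |T(a,b,w)| ≤
(sup|â|)^(1/2)(∫|â|²)^(1/4)(∫|b̂|²)^(1/2)(∫|ŵ|⁴)^(1/4)) → FourthMomentAP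
(∫|ŵ_AP|⁴ = ∫|f̂_HB|⁴, proved: norm_expSumOf_apWeight) → ErrorTermBoundAP; MainTermLowerAP ⇐
RoughModelPairCountLower (Σ_(n₁+n₂=k) g g ≥ c₀ k
for even k ∈ (M/2, M]) → MassLower (Σ_k w(k) ≥ (κ/16) η² (2N)) → MainTermLowerAP. Both splits exist
as theorems in the evidence file
(holderCounting_holds, integral_fourth_apWeight, ternarySum_ge_fibre, mass_ge); filed only if a
porting prover asks.

KILL CRITERIA. Nothing mathematical can kill the line: target and all five blocks are kernel-checked
(evidence sha256 99bf7ec1…, check.json beside it).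
The route is MOOTED (close --reason superseded) if the operator/lit seat ports the evidence file
directly into
Summits/Parity/GeneralizedHardyLittlewood/Theorems/ (then `theorem … : HeathBrownPrimeAP3` closes
the target without items); it stays DRAFT
(glue.conclusion-mismatch by design, D-0061 option (i)) until the target item
`Summit.Parity.GeneralizedHardyLittlewood.Theses.HeathBrownPrimeAP3.HeathBrownPrimeAP3`
is registered as the F-P1 rung ALT-CLOSER (then `ledger route edit <id> --closes-target <that FQN>
--closes-file glue.lean`; if the operator lands an
independent leaf instead, the same edit with that leaf — bodies are `rfl`-equal); if registration is
refused the items still serve the sibling port-route VinogradovHeathBrown.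

NOT DECOMPOSED YET. The 1805-line E2 block (Vaughan identity, type I/II sums, Siegel–Walfisz major
arcs) and the E5/E6 lemmas are not itemised: they are
support-level ports with verbatim texts (lit pre-split files port/LineERoughModel.lean,
port/LineEVinogradovHeathBrown.lean); constants
(C'' = 45, N₀ = 126, c_M = c₀κ/32, A = 8c + C₄⁺ + 8) are fixed by the evidence and need no tuning.

CHEAPEST FALSIFIER. Already run: the whole line was elaborated on the farm (lean check rc 0, 0
errors, 0 warnings, 0 sorries, --axioms standard) before
filing, and `ledger route check --native route.json --closes-file glue.lean` renders and elaborates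
every item + `closes` against the landed
CubicMinorantDefs (p407241) — a namespace/normalisation mismatch there is the one thing that can
bounce the port (run 2026-08-25: all items elaborate;
only the by-design pre-flight conclusion-mismatch remains until the ALT-CLOSER registration).

DEFINITION REQUESTS. Operator landing WANTED (planners cannot propose; texts farm-checked rc 0,
published at pub/parity-ideate/parity-ideate-p2/leaves/):
(D1) DONE — the defs leaf LANDED as Literature/NumberTheory/Sieve/CubicMinorantDefs.lean (lit seat
p407241, commit ac6922f92647, namespace Literature.NumberTheory.Sieve.CubicMinorant: expSumOf,
ternarySum, vmWeight, roughPrimorial, roughLevel, roughModel, gWeight, roughExpSum, hbX, hbEta,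
hbRep, hbWeight, hbExpSum, apWeight), over which every item above is typed; (D2) NO LEAF NEEDED
under D-0061 option (i): the target item of this route
(`…Theses.HeathBrownPrimeAP3.HeathBrownPrimeAP3`, body = leaves/HeathBrownPrimeAP3Statement.lean
verbatim) is the rung leaf; WANTED = its ALT-CLOSER registration
(sub Parity/GeneralizedHardyLittlewood, class rung, rung F-P1); (D3) idem for the sibling route
VinogradovHeathBrown. No Literature notion is missing; cite facts: none (Hua landed as p406333,
Heath-Brown and Vinogradov are tree theorems/facts).

Novelty: Label of record (tribunal J 2026-08-26T08:56:37Z, tier A, ledger FRONTIER): «prime 3-APs with a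
Heath-Brown middle term π = x³+2y³ ∈ (N/2, N] — new additive theorem for an N^{2/3−o(1)}-sparse
special set with no density / distribution hypothesis; ternary-shaped weighted circle method + Hua
L⁴ restriction; log savings; ineffective N₀; FRONTIER; no bearing on prime pairs / parity / GHL».
Searches (2026-08-25): lit search "Goldbach numbers sparse sequences polynomial values" (4 relevant:
BrudernPerelli1998 Thm 1, BKW 2000 ARTS II doi:10.1112/s002557930001576x Thm 1–2, Perelli 1996,
Sankaranarayanan 1999); lit search "arithmetic progression" primes "of the form" x^2+y^2+1 (2:
arXiv:1610.04044, arXiv:1611.08585); lit search --hybrid "three primes in arithmetic progression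
middle term special set" (generic textbook hits only); lit galaxy search "Piatetski-Shapiro primes
in arithmetic progression|three primes in arithmetic progression|p_1+p_2=2p_3" --star all (0
research hits; [galaxy:pdf:5071576680] Maier–Rassias unrelated); arXiv API "Goldbach binary cubic
form primes x^3+2y^3" (0); lit frontier/bridges Parity from the Line E pass (LIT-PACK §2.13:
Balog–Friedlander 1992, Maier–Rassias 2017, GrimmeltMerikoski2025 — all need positive relative
density or Siegel–Walfisz-type equidistribution of the special set).
Nearest prior art found: arXiv:1610.04044 (S. I. Dimitrov 2016/17: prime 3-APs p₁+p₃ = 2p₂ with TWO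
terms of the form x²+y²+1 — a positive-density subset of primes, linear sie  [refs: 10.1112/s002557930001576x, 10.1112/s0025579317000341, 10.5802/aif.1621, 10.1112/s0025579317000341:, 1610.04044, 1611.08585, doi:10.1112/s002557930001576x, doi:10.1112/s0025579317000341, doi:10.5802/aif.1621, BrudernPerelli1998, GrimmeltMerikoski2025, BrudernKawadaWooley2000]

Barriers (technique_class: circle-method, weighted-restriction, thin-middle-variable): - technique_class: circle-method, weighted-restriction, thin-middle-variable
- Literature.Barriers.Parity.CircleMethodBinaryBarrier: outside its class — the count is TERNARY in
the circle-method sense (two free prime variables p, r plus the weighted middle variable π, linear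
system (n₁, n₂, n₁+n₂ = 2π) with three summands): the minor arcs are bounded by Hölder ∫|S|²|F| ≤
(sup|S| on 𝔪)^(1/2)(∫|S|²)^(3/4)(∫|F|⁴)^(1/4) where the thin weight's L⁴ norm
(HBFourierFourthMoment) supplies the saving — the barrier quantifies over BINARY correlations ∫ S W̄
e(−hα) with one fixed shift, which this count is not.
- Literature.Barriers.Parity.RedactedPrimes: outside — the inputs are of three-primes strength
(Vinogradov/Vaughan sup bound x(log x)^(−A) on the minor arcs and Siegel–Walfisz major arcs at
precision x(log x)^(−B)), which the barrier's audit lists as OUTSIDE the loose-information class,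
and the conclusion is a ternary count, not R(x) > 0 for a given even x.
- Literature.Barriers.Parity.GoldbachAverageZerosNarrow: not met — no power saving is claimed or
implied anywhere: all savings are powers of log N (error exponent −2c − 1/4 vs main −2c), and the
conclusion (prime 3-APs with a Heath-Brown middle term) implies no `PowerSavingGoldbachAverage δ`.
- Literature.Barriers.Parity.GoldbachAverageZeros: idem — log-power savings only; the explicit
formula / zeros of L-functions never enter (Siegel–Walfisz at level (log N)^B is the only
distributional input, ineffective N₀ allowed since the

History (route lifecycle, newest last):
- 2026-08-26T08:03:15Z · closes_target -> closes rung F-P1 of Parity: Summit.Parity.GeneralizedHardyLittlewood.Theses.HeathBrownPrimeAP3.HeathBrownPrimeAP3 (D-0061; not the summit Statement) (operator:999:3022460)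
- 2026-08-26T18:18:41Z · CLOSED proved — proved:Summit.Parity.GeneralizedHardyLittlewood.Theses.HeathBrownPrimeAP3.heathBrownPrimeAP3_holds (planner-parity-ideate-p2-g5-0)

sub-problem: GeneralizedHardyLittlewood · status: closed(proved) · opened planner-parity-ideate-p2-g4-0 2026-08-25T22:05:12Z · rev 3 · ledger route-Parity-HeathBrownPrimeAP3
GENERATED by the gate from the ledger (D-0016/17). Provers cite these decls: `theorem foo : Summit.Parity.GeneralizedHardyLittlewood.Theses.HeathBrownPrimeAP3.<Decl> := …` in Summits/Parity/GeneralizedHardyLittlewood/Theorems/<Name>.lean.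
-/

namespace Summit.Parity.GeneralizedHardyLittlewood.Theses.HeathBrownPrimeAP3

open scoped BigOperators Topology Manifold Classical MeasureTheory ProbabilityTheory Matrix InnerProductSpace ComplexConjugate ContinuousMap
open Filter Set Function TopologicalSpace MeasureTheory

attribute [summit_statement] _root_.GeneralizedHardyLittlewood
-- H21.Audit: the closer leaf Summit.Parity.GeneralizedHardyLittlewood.Theses.HeathBrownPrimeAP3.HeathBrownPrimeAP3 is an item decl of this route file — tagged summit_statement below, after its declaration

/-- item stmt-Parity-19662 · target · rank 0 · closed · proved by Summit.Parity.GeneralizedHardyLittlewood.Theses.HeathBrownPrimeAP3.heathBrownPrimeAP3_holds @ 6d99ae611af7 (reviewer) · by planner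
why it might fail: it cannot mathematically (kernel-proved); heathBrownPrimeAP3_holds := closes … is in port file 6/6 (farm rc 0 in the chained check); lands after files 1–5.
sources: HeathBrownActa2001, Green2005, Vaughan1997
[target] the rung leaf itself, as this route's target item (D-0061 option (i), precedent
route-Parity-FordMaynardNoSieveConst0164): there is N₀ such that for every N ≥ N₀ there are primes
p, r and a prime x³+2y³ (x, y ≥ 1) with p < x³+2y³, p + r = 2(x³+2y³) and N/2 < x³+2y³ ≤ N —
byte-identical body to the refereed leaf text
`pub/parity-ideate/parity-ideate-p2/leaves/HeathBrownPrimeAP3Statement.lean` (= `rfl` to the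
operator leaf `Summit.Parity.GeneralizedHardyLittlewood.HeathBrownPrimeAP3` if/when that is landed);
to be registered as the rung's ALT-CLOSER, after which `route edit --closes-target` serves the
route. KERNEL-PROVED in cell evidence (`ParityIdeateP2.LineF.heathBrownPrimeAP3_holds`,
evidence/LineEFG_tree.lean, rc 0, axioms std). -/
@[route_item "route-Parity-HeathBrownPrimeAP3"]
def HeathBrownPrimeAP3 : Prop :=
  ∃ N₀ : ℕ, ∀ N : ℕ, N₀ ≤ N → ∃ p r x y : ℕ, 0 < x ∧ 0 < y ∧ p.Prime ∧ r.Prime ∧ (x ^ 3 + 2 * y ^ 3).Prime ∧ p < x ^ 3 + 2 * y ^ 3 ∧ p + r = 2 * (x ^ 3 + 2 * y ^ 3) ∧ N < 2 * (x ^ 3 + 2 * y ^ 3) ∧ x ^ 3 + 2 * y ^ 3 ≤ N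

-- `HeathBrownPrimeAP3` holds: proved by `Summit.Parity.GeneralizedHardyLittlewood.Theses.HeathBrownPrimeAP3.heathBrownPrimeAP3_holds` @ 6d99ae611af7 (its module imports this route file, so no `_holds` link can be stated here).

/-- item stmt-Parity-19663 · crux · rank 2 · closed · proved by Summit.Parity.GeneralizedHardyLittlewood.Theses.HeathBrownPrimeAP3.errorTermBoundAP_holds (reviewer) · by planner
why it might fail: PROVED in cell evidence (errorTermBoundAP_holds) and port-ready (HeathBrownPrimeAP3ErrorTerm.lean, farm rc 0); Hua-normalisation risk discharged by the landed hbFourierFourthMoment_holds; residual risk = a gate dedup.landed bounce on a helper (mechanical rename).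
sources: Vaughan1997, GreenTao2006Restriction, Vaughan1986Cubes
[crux] for the AP weight at scale 2N, |T(Λ,Λ,w) − T(g_B,g_B,w)| ≤ C'(2N)²(log 2N)^((1−A)/4+3/2+C₄/4)
given E2's sup bound with exponent A and the fourth-moment bound with exponent C₄ (block F2 of the
evidence; E5 Hölder counting lemma at scale 2N). [difficulty: M] -/
@[route_item "route-Parity-HeathBrownPrimeAP3", crux]
def ErrorTermBoundAP : Prop :=
  ∀ c : ℝ, 0 < c → ∀ C₄ c₁ : ℝ, 0 ≤ C₄ → (∀ N : ℕ, 3 ≤ N → ∫ α in (0 : ℝ)..1, ‖Literature.NumberTheory.Sieve.CubicMinorant.hbExpSum c N α‖ ^ 4 ≤ c₁ * (N : ℝ) ^ 3 * Real.log N ^ C₄) → ∀ A B C : ℝ, 0 < A → 0 < B → ∀ N₂ : ℕ, (∀ N : ℕ, N₂ ≤ N → ∀ α : ℝ, ‖Literature.NumberTheory.Sieve.primeExpSum N α - Literature.NumberTheory.Sieve.CubicMinorant.roughExpSum B N α‖ ≤ C * (N : ℝ) * Real.log N ^ (-A)) → ∃ C' : ℝ, ∃ N₀ : ℕ, ∀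 N : ℕ, N₀ ≤ N → |Literature.NumberTheory.Sieve.CubicMinorant.ternarySum (Literature.NumberTheory.Sieve.CubicMinorant.vmWeight (2 * N)) (Literature.NumberTheory.Sieve.CubicMinorant.vmWeight (2 * N)) (Literature.NumberTheory.Sieve.CubicMinorant.apWeight c N) (2 * N) - Literature.NumberTheory.Sieve.CubicMinorant.ternarySum (Literature.NumberTheory.Sieve.CubicMinorant.gWeight B (2 * N)) (Literature.NumberTheory.Sieve.CubicMinorant.gWeight B (2 * N)) (Literature.NumberTheory.Sieve.CubicMinorant.apWeight c N) (2 * N)| ≤ C' * ((2 * N : ℕ) : ℝ) ^ 2 * Real.log ((2 * N : ℕ) : ℝ) ^ ((1 - A) / 4 + 3 / 2 + C₄ / 4)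

-- `ErrorTermBoundAP` holds: proved by `Summit.Parity.GeneralizedHardyLittlewood.Theses.HeathBrownPrimeAP3.errorTermBoundAP_holds` (its module imports this route file, so no `_holds` link can be stated here).

/-- item stmt-Parity-19664 · crux · rank 3 · closed · proved by Summit.Parity.GeneralizedHardyLittlewood.Theses.HeathBrownPrimeAP3.mainTermLowerAP_holds (reviewer) · by planner
why it might fail: PROVED in cell evidence (mainTermLowerAP_holds, c_M = c₀κ/32) and port-ready (HeathBrownPrimeAP3MainTerm.lean, farm rc 0); residual risk = gate dedup/lint bounce only; the evenness of k = 2π and W = W(B,2N) match the landed CubicMinorantDefs verbatim (checked by elaboration).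
sources: HeathBrownActa2001, Nathanson1996
[crux] the rough-model main term: T(g_B, g_B, w) ≥ c_M (log 2N)^(−2c) (2N)² for N ≥ N₀, from the
rough-pair lower bound Σ_(n₁+n₂=2π) g g ≥ c₀·2π uniformly in even 2π ∈ (N, 2N] and Heath-Brown's
count of π (block F1; needs HB's lower bound as the hypothesis displayed). [difficulty: M] -/
@[route_item "route-Parity-HeathBrownPrimeAP3", crux]
def MainTermLowerAP : Prop :=
  ∀ c : ℝ, 0 < c → ∀ κ : ℝ, 0 < κ → (∀ᶠ X : ℝ in atTop, κ * ((Real.log X ^ (-c)) ^ 2 * X ^ 2 / Real.log X) ≤ Literature.NumberTheory.Sieve.CubicPrimes.primePairCount X (Real.log X ^ (-c))) → ∀ B : ℝ, 0 < B → ∃ cM : ℝ, 0 < cM ∧ ∃ N₀ : ℕ, ∀ N : ℕ, N₀ ≤ N → cM * Real.log ((2 * N : ℕ) : ℝ) ^ (-(2 * c)) * ((2 * N : ℕ) : ℝ) ^ 2 ≤ Literature.NumberTheory.Sieve.CubicMinorant.ternarySum (Literature.NumberTheory.Sieve.CubicMinorant.gWeight B (2 * N)) (Literature.NumberTheory.Sieve.CubicMinorant.gWeight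 B (2 * N)) (Literature.NumberTheory.Sieve.CubicMinorant.apWeight c N) (2 * N)

-- `MainTermLowerAP` holds: proved by `Summit.Parity.GeneralizedHardyLittlewood.Theses.HeathBrownPrimeAP3.mainTermLowerAP_holds` (its module imports this route file, so no `_holds` link can be stated here).

/-- item stmt-Parity-19665 · crux · rank 4 · closed · proved by Summit.Parity.GeneralizedHardyLittlewood.Theses.HeathBrownPrimeAP3.readoutAP_holds (reviewer) · by planner
why it might fail: PROVED in cell evidence (readoutAP_holds, C'' = 45, N₀ = 126) and port-ready (HeathBrownPrimeAP3Readout.lean, farm rc 0); residual risk = gate dedup/lint bounce only.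
sources: HeathBrownActa2001, Nathanson1996
[crux] if no Heath-Brown prime π ∈ (N/2, N] is the middle of a non-trivial prime 3-AP then T(Λ,Λ,w)
≤ C''(2N)^(3/2)(log 2N)⁴: only the diagonal n₁ = n₂ = π and prime-power terms survive (block F3, C''
= 45, N₀ = 126). [difficulty: S] -/
@[route_item "route-Parity-HeathBrownPrimeAP3", crux]
def ReadoutAP : Prop :=
  ∀ c : ℝ, 0 < c → ∃ C'' : ℝ, ∃ N₀ : ℕ, ∀ N : ℕ, N₀ ≤ N → (¬ ∃ p r x y : ℕ, 0 < x ∧ 0 < y ∧ p.Prime ∧ r.Prime ∧ (x ^ 3 + 2 * y ^ 3).Prime ∧ p < x ^ 3 + 2 * y ^ 3 ∧ p + r = 2 * (x ^ 3 + 2 * y ^ 3) ∧ N < 2 * (x ^ 3 + 2 * y ^ 3) ∧ x ^ 3 + 2 * y ^ 3 ≤ N) → Literature.NumberTheory.Sieve.CubicMinorant.ternarySum (Literature.NumberTheory.Sieve.CubicMinorant.vmWeight (2 * N)) (Literature.NumberTheory.Sieve.CubicMinorant.vmWeight (2 * N)) (Literature.NumberTheory.Sieve.CubicMinorant.apWeight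 c N) (2 * N) ≤ C'' * ((2 * N : ℕ) : ℝ) ^ ((3 : ℝ) / 2) * Real.log ((2 * N : ℕ) : ℝ) ^ (4 : ℝ)

-- `ReadoutAP` holds: proved by `Summit.Parity.GeneralizedHardyLittlewood.Theses.HeathBrownPrimeAP3.readoutAP_holds` (its module imports this route file, so no `_holds` link can be stated here).

/-- item stmt-Parity-19666 · support · rank 9 · closed · moot by None · by planner
sources: Vaughan1997, IwaniecKowalski2004, Green2005
[support] E2 of Line E (shared with route VinogradovHeathBrown): for every A > 0 there is B > 0 with
sup_α |Λ̂_N(α) − ĝ_(B,N)(α)| ≤ C N (log N)^(−A), g the W-rough model of level (log N)^B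
(Siegel–Walfisz on major arcs, Vaughan/Vinogradov on minor arcs; PROVED in evidence, 1805-line
block, lit port text port/LineERoughModel.lean). [difficulty: L] -/
@[route_item "route-Parity-HeathBrownPrimeAP3", crux]
def RoughModelFourierApprox : Prop :=
  ∀ A : ℝ, 0 < A → ∃ B : ℝ, 0 < B ∧ ∃ C : ℝ, ∃ N₀ : ℕ, ∀ N : ℕ, N₀ ≤ N → ∀ α : ℝ, ‖Literature.NumberTheory.Sieve.primeExpSum N α - Literature.NumberTheory.Sieve.CubicMinorant.roughExpSum B N α‖ ≤ C * (N : ℝ) * Real.log N ^ (-A)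

/-- item stmt-Parity-19667 · support · rank 9 · closed · moot by None · by planner
sources: Vaughan1986Cubes, Vaughan1997, HeathBrownActa2001
[support] E4 of Line E (shared): ∫₀¹ |Σ_π hbWeight(π) e(πα)|⁴ dα ≤ c₁ N³ (log N)^C — from Hua's
eighth-moment lemma with logarithmic loss (tree theorem huaEighthMomentLog_holds, p406333) via the
PROVED reduction hbFourthMomentReduction (Cauchy–Schwarz in y, sixteen-fold cubic equation count).
[difficulty: M] -/
@[route_item "route-Parity-HeathBrownPrimeAP3", crux]
def HBFourierFourthMoment : Prop :=
  ∀ c : ℝ, 0 < c → ∃ C c₁ : ℝ, ∀ N : ℕ, 3 ≤ N → ∫ α in (0 : ℝ)..1, ‖Literature.NumberTheory.Sieve.CubicMinorant.hbExpSum c N α‖ ^ 4 ≤ c₁ * (N : ℝ) ^ 3 * Real.log N ^ C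

/-- item stmt-Parity-19668 · assembly · rank 1 · closed · moot by None · by planner
sources: HeathBrownActa2001, Vinogradov1937
[assembly] MainTermLowerAP → ErrorTermBoundAP → ReadoutAP → RoughModelFourierApprox →
HBFourierFourthMoment → HeathBrownPrimeAP3 (the target item = the rung leaf). The deciding theorem
`closes` (glue.lean) PROVES this item inline (`have hA : Assembly := …` = the evidence theorem
`heathBrownPrimeAP3_of_parts` with Heath-Brown's lower bound derived from the tree) and applies it,
so every declared item is in the cone of `closes` (BC6). Until the target is registered as
ALT-CLOSER the gate reads the conclusion as glue.conclusion-mismatch and the route is DRAFT by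
design. -/
@[route_item "route-Parity-HeathBrownPrimeAP3"]
def Assembly : Prop :=
  MainTermLowerAP → ErrorTermBoundAP → ReadoutAP → RoughModelFourierApprox → HBFourierFourthMoment → HeathBrownPrimeAP3

attribute [summit_statement] _root_.Summit.Parity.GeneralizedHardyLittlewood.Theses.HeathBrownPrimeAP3.HeathBrownPrimeAP3

/-! D-0027 §2.1 — DECIDING THEOREM (planner-authored via `route open/edit --closes-file`; by operator:999:3022460 2026-08-26T08:03:15Z) — ARCHIVED: route closed (proved) 2026-08-26T18:18:41Z; kept so importers keep building:
its hypotheses are this route's items and its conclusion the registered leaf `Summit.Parity.GeneralizedHardyLittlewood.Theses.HeathBrownPrimeAP3.HeathBrownPrimeAP3` (rung F-P1, D-0061) (glue_lint), and it elaborates with this file. -/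

/-! D-0027 §2.1 deciding theorem of the port route: the five blocks imply the target item (= the rung leaf, D-0061 option (i)). Adapted verbatim from the
cell evidence theorem `heathBrownPrimeAP3_of_parts` (KERNEL-PROVED there together with all five hypotheses), with Heath-Brown's
lower bound `π(𝒜)(X,(log X)^{-c}) ≥ κ η² X²/log X` (A0) derived inline from the tree theorem
`CubicPrimes.HeathBrown2001_primePairCount_asymptotic_holds`. -/

@[closes "route-Parity-HeathBrownPrimeAP3"] theorem closes (h₁ : MainTermLowerAP) (h₂ : ErrorTermBoundAP) (h₃ : ReadoutAP)
    (hE2 : RoughModelFourierApprox) (hE4b : HBFourierFourthMoment) :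
    HeathBrownPrimeAP3 := by
  -- the Assembly item IS the composition; prove it (the cell evidence theorem `heathBrownPrimeAP3_of_parts`, with
  -- Heath-Brown's lower bound A0 derived from the tree), then apply it — keeps `Assembly` in the cone of `closes` (BC6)
  have hA : Assembly := by
    intro h₁ h₂ h₃ hE2 hE4b
    show ∃ N₀ : ℕ, ∀ N : ℕ, N₀ ≤ N → ∃ p r x y : ℕ, 0 < x ∧ 0 < y ∧ p.Prime ∧ r.Prime ∧ (x ^ 3 + 2 * y ^ 3).Prime ∧
      p < x ^ 3 + 2 * y ^ 3 ∧ p + r = 2 * (x ^ 3 + 2 * y ^ 3) ∧ N < 2 * (x ^ 3 + 2 * y ^ 3) ∧ x ^ 3 + 2 * y ^ 3 ≤ N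
    have hA0 : ∃ c : ℝ, 0 < c ∧ ∃ κ : ℝ, 0 < κ ∧ ∀ᶠ X : ℝ in atTop,
        κ * ((Real.log X ^ (-c)) ^ 2 * X ^ 2 / Real.log X) ≤
          Literature.NumberTheory.Sieve.CubicPrimes.primePairCount X (Real.log X ^ (-c)) := by
      obtain ⟨c, hc, σ₀, hσ₀, -, hO⟩ :=
        Literature.NumberTheory.Sieve.CubicPrimes.HeathBrown2001_primePairCount_asymptotic_holds
      refine ⟨c, hc, σ₀ / 6, by positivity, ?_⟩
      obtain ⟨C, hC⟩ := hO.bound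
      have hg : Tendsto (fun X : ℝ => Real.log (Real.log X) ^ (-(1 / 6 : ℝ))) atTop (𝓝 0) :=
        (tendsto_rpow_neg_atTop (by norm_num : (0 : ℝ) < 1 / 6)).comp
          (Real.tendsto_log_atTop.comp Real.tendsto_log_atTop)
      have h1 : ∀ᶠ X : ℝ in atTop, |C| * |Real.log (Real.log X) ^ (-(1 / 6 : ℝ))| < 1 / 2 := by
        have h' := hg.abs.const_mul |C|
        rw [abs_zero, mul_zero] at h'
        exact h'.eventually (gt_mem_nhds (by norm_num))
      filter_upwards [hC, h1, eventually_gt_atTop (1 : ℝ)] with X hCX h1X hX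
      have hM : 0 < Literature.NumberTheory.Sieve.CubicPrimes.mainTerm c σ₀ X := Literature.NumberTheory.Sieve.CubicPrimes.mainTerm_pos hσ₀ hX
      have hlt : |(Literature.NumberTheory.Sieve.CubicPrimes.primePairCount X (Real.log X ^ (-c)) : ℝ) - Literature.NumberTheory.Sieve.CubicPrimes.mainTerm c σ₀ X| ≤
          Literature.NumberTheory.Sieve.CubicPrimes.mainTerm c σ₀ X * (1 / 2) := by
        calc |(Literature.NumberTheory.Sieve.CubicPrimes.primePairCount X (Real.log X ^ (-c)) : ℝ) - Literature.NumberTheory.Sieve.CubicPrimes.mainTerm c σ₀ X|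
            ≤ C * ‖Literature.NumberTheory.Sieve.CubicPrimes.mainTerm c σ₀ X * Real.log (Real.log X) ^ (-(1 / 6 : ℝ))‖ := by
              simpa only [Real.norm_eq_abs] using hCX
          _ ≤ |C| * ‖Literature.NumberTheory.Sieve.CubicPrimes.mainTerm c σ₀ X * Real.log (Real.log X) ^ (-(1 / 6 : ℝ))‖ :=
              mul_le_mul_of_nonneg_right (le_abs_self C) (norm_nonneg _)
          _ = Literature.NumberTheory.Sieve.CubicPrimes.mainTerm c σ₀ X * (|C| * |Real.log (Real.log X) ^ (-(1 / 6 : ℝ))|) := by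
              rw [Real.norm_eq_abs, abs_mul, abs_of_pos hM]; ring
          _ ≤ Literature.NumberTheory.Sieve.CubicPrimes.mainTerm c σ₀ X * (1 / 2) := mul_le_mul_of_nonneg_left h1X.le hM.le
      have h2 := (abs_sub_le_iff.1 hlt).2
      calc σ₀ / 6 * ((Real.log X ^ (-c)) ^ 2 * X ^ 2 / Real.log X)
          = Literature.NumberTheory.Sieve.CubicPrimes.mainTerm c σ₀ X - Literature.NumberTheory.Sieve.CubicPrimes.mainTerm c σ₀ X * (1 / 2) := by rw [Literature.NumberTheory.Sieve.CubicPrimes.mainTerm_def]; ring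
        _ ≤ _ := by linarith
    obtain ⟨c, hc, κ, hκ, hHB⟩ := hA0
    obtain ⟨C₄, c₁, h4⟩ := hE4b c hc
    -- raise the constants of E4b to non-negative ones
    have hC₄' : 0 ≤ max C₄ 0 := le_max_right _ _
    have h4' : ∀ N : ℕ, 3 ≤ N →
        ∫ α in (0 : ℝ)..1, ‖Literature.NumberTheory.Sieve.CubicMinorant.hbExpSum c N α‖ ^ 4 ≤ max c₁ 0 * (N : ℝ) ^ 3 * Real.log N ^ max C₄ 0 := by
      intro N hN
      have h3 : (3 : ℝ) ≤ N := by exact_mod_cast hN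
      have hNpos : (0 : ℝ) < N := by linarith
      have hL1 : 1 ≤ Real.log N := by
        rw [Real.le_log_iff_exp_le hNpos]
        have := Real.exp_one_lt_d9
        linarith
      have hL0 : 0 < Real.log N := by linarith
      refine (h4 N hN).trans ?_
      calc c₁ * (N : ℝ) ^ 3 * Real.log N ^ C₄ ≤ max c₁ 0 * (N : ℝ) ^ 3 * Real.log N ^ C₄ :=
            mul_le_mul_of_nonneg_right (mul_le_mul_of_nonneg_right (le_max_left _ _) (by positivity))
              (Real.rpow_nonneg hL0.le _)
        _ ≤ max c₁ 0 * (N : ℝ) ^ 3 * Real.log N ^ max C₄ 0 :=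
            mul_le_mul_of_nonneg_left (Real.rpow_le_rpow_of_exponent_le hL1 (le_max_left _ _))
              (by positivity)
    -- the choice of `A`
    have hApos : 0 < 8 * c + max C₄ 0 + 8 := by positivity
    obtain ⟨B, hB, C, N₂, h2⟩ := hE2 (8 * c + max C₄ 0 + 8) hApos
    obtain ⟨cM, hcM, N₁, h1⟩ := h₁ c hc κ hκ hHB B hB
    obtain ⟨C', N₃, h3⟩ :=
      h₂ c hc (max C₄ 0) (max c₁ 0) hC₄' h4' (8 * c + max C₄ 0 + 8) B C hApos hB N₂ h2
    obtain ⟨C'', N₄, h5⟩ := h₃ c hc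
    have hexp : (1 - (8 * c + max C₄ 0 + 8)) / 4 + 3 / 2 + max C₄ 0 / 4 =
        -(2 * c) + -(1 / 4 : ℝ) := by ring
    -- (i) `C' (log n)^{-1/4} ≤ c_M / 3` eventually
    have hev1 : ∀ᶠ n : ℕ in atTop, C' * Real.log n ^ (-(1 / 4 : ℝ)) ≤ cM / 3 := by
      have hg : Tendsto (fun n : ℕ => C' * Real.log n ^ (-(1 / 4 : ℝ))) atTop (𝓝 (C' * 0)) :=
        ((tendsto_rpow_neg_atTop (by norm_num : (0 : ℝ) < 1 / 4)).comp
          (Real.tendsto_log_atTop.comp tendsto_natCast_atTop_atTop)).const_mul C'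
      rw [mul_zero] at hg
      exact (hg.eventually (gt_mem_nhds (by positivity : (0 : ℝ) < cM / 3))).mono fun n h => h.le
    -- (ii) `|C''| (log n)^{4 + 2c} ≤ (c_M/3) n^{1/2}` eventually
    have hev2 : ∀ᶠ n : ℕ in atTop,
        |C''| * Real.log n ^ (4 + 2 * c) ≤ cM / 3 * (n : ℝ) ^ ((1 : ℝ) / 2) := by
      have ho := (isLittleO_log_rpow_rpow_atTop (4 + 2 * c) (by norm_num : (0 : ℝ) < 1 / 2)).def
        (show (0 : ℝ) < cM / 3 / (|C''| + 1) by positivity)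
      filter_upwards [tendsto_natCast_atTop_atTop.eventually ho] with n hn
      have hL0 : 0 ≤ Real.log n := Real.log_natCast_nonneg n
      rw [Real.norm_of_nonneg (Real.rpow_nonneg hL0 _),
        Real.norm_of_nonneg (Real.rpow_nonneg (Nat.cast_nonneg n) _)] at hn
      have hC0 : 0 ≤ |C''| := abs_nonneg _
      have hfrac : |C''| * (cM / 3 / (|C''| + 1)) ≤ cM / 3 := by
        rw [mul_div_assoc', div_le_iff₀ (by positivity)]
        nlinarith
      calc |C''| * Real.log n ^ (4 + 2 * c)
          ≤ |C''| * (cM / 3 / (|C''| + 1) * (n : ℝ) ^ ((1 : ℝ) / 2)) :=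
            mul_le_mul_of_nonneg_left hn hC0
        _ = |C''| * (cM / 3 / (|C''| + 1)) * (n : ℝ) ^ ((1 : ℝ) / 2) := by ring
        _ ≤ cM / 3 * (n : ℝ) ^ ((1 : ℝ) / 2) := mul_le_mul_of_nonneg_right hfrac (by positivity)
    obtain ⟨N₅, hN₅⟩ := Filter.eventually_atTop.1 (hev1.and (hev2.and (eventually_gt_atTop 6)))
    refine ⟨N₁ + N₃ + N₄ + N₅, fun N hN => ?_⟩
    obtain ⟨hi, hii, hM6⟩ := hN₅ (2 * N) (by omega)
    by_contra hno
    have hT := h5 N (by omega) hno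
    have hM := h1 N (by omega)
    have hE := h3 N (by omega)
    rw [hexp] at hE
    have hE' := (abs_sub_le_iff.1 hE).2
    set M : ℝ := ((2 * N : ℕ) : ℝ) with hMdef
    have hMpos : (0 : ℝ) < M := by rw [hMdef]; exact_mod_cast (show 0 < 2 * N by omega)
    have hL0 : 0 < Real.log M := Real.log_pos (by rw [hMdef]; exact_mod_cast (show 1 < 2 * N by omega))
    have hQpos : 0 < M ^ 2 * Real.log M ^ (-(2 * c)) := by positivity
    -- (a) `c_M M² (log M)^{-2c} ≤ T(g, g, w)`
    have ha : cM * (M ^ 2 * Real.log M ^ (-(2 * c))) ≤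
        Literature.NumberTheory.Sieve.CubicMinorant.ternarySum (Literature.NumberTheory.Sieve.CubicMinorant.gWeight B (2 * N)) (Literature.NumberTheory.Sieve.CubicMinorant.gWeight B (2 * N)) (Literature.NumberTheory.Sieve.CubicMinorant.apWeight c N) (2 * N) := by
      calc cM * (M ^ 2 * Real.log M ^ (-(2 * c))) = cM * Real.log M ^ (-(2 * c)) * M ^ 2 := by ring
        _ ≤ _ := hM
    -- (b) the E2/E5/E4 error is `≤ (c_M/3) M² (log M)^{-2c}`
    have hb : C' * M ^ 2 * Real.log M ^ (-(2 * c) + -(1 / 4 : ℝ)) ≤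
        cM / 3 * (M ^ 2 * Real.log M ^ (-(2 * c))) := by
      rw [Real.rpow_add hL0]
      calc C' * M ^ 2 * (Real.log M ^ (-(2 * c)) * Real.log M ^ (-(1 / 4 : ℝ)))
          = C' * Real.log M ^ (-(1 / 4 : ℝ)) * (M ^ 2 * Real.log M ^ (-(2 * c))) := by ring
        _ ≤ cM / 3 * (M ^ 2 * Real.log M ^ (-(2 * c))) :=
            mul_le_mul_of_nonneg_right hi hQpos.le
    -- (c) the read-out junk is `≤ (c_M/3) M² (log M)^{-2c}`
    have hc' : C'' * M ^ ((3 : ℝ) / 2) * Real.log M ^ (4 : ℝ) ≤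
        cM / 3 * (M ^ 2 * Real.log M ^ (-(2 * c))) := by
      have hsplitL : Real.log M ^ (4 : ℝ) = Real.log M ^ (4 + 2 * c) * Real.log M ^ (-(2 * c)) := by
        rw [← Real.rpow_add hL0]; congr 1; ring
      have hsplitN : M ^ 2 = M ^ ((1 : ℝ) / 2) * M ^ ((3 : ℝ) / 2) := by
        rw [← Real.rpow_add hMpos, ← Real.rpow_natCast]; congr 1; norm_num
      calc C'' * M ^ ((3 : ℝ) / 2) * Real.log M ^ (4 : ℝ)
          ≤ |C''| * M ^ ((3 : ℝ) / 2) * Real.log M ^ (4 : ℝ) :=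
            mul_le_mul_of_nonneg_right (mul_le_mul_of_nonneg_right (le_abs_self _) (by positivity))
              (by positivity)
        _ = |C''| * Real.log M ^ (4 + 2 * c) * (M ^ ((3 : ℝ) / 2) * Real.log M ^ (-(2 * c))) := by
            rw [hsplitL]; ring
        _ ≤ cM / 3 * M ^ ((1 : ℝ) / 2) * (M ^ ((3 : ℝ) / 2) * Real.log M ^ (-(2 * c))) :=
            mul_le_mul_of_nonneg_right hii (by positivity)
        _ = cM / 3 * (M ^ 2 * Real.log M ^ (-(2 * c))) := by rw [hsplitN]; ring
    -- contradiction: `c_M Q ≤ T(g,g,w) ≤ T(Λ,Λ,w) + (c_M/3) Q ≤ (2 c_M/3) Q` with `Q > 0`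
    have hprod : 0 < cM * (M ^ 2 * Real.log M ^ (-(2 * c))) := mul_pos hcM hQpos
    linarith
  exact hA h₁ h₂ h₃ hE2 hE4b

end Summit.Parity.GeneralizedHardyLittlewood.Theses.HeathBrownPrimeAP3
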